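import Mathlib.NumberTheory.Real.Irrational
import Literature.NumberTheory.Automorphic.StrongArtinGL2
import Literature.NumberTheory.Automorphic.AutomorphicRepCentralCharacter
import Literature.NumberTheory.Automorphic.AutomorphicTwist
import Literature.NumberTheory.Automorphic.AutomorphicRepDataSplitCenter
import Literature.NumberTheory.Automorphic.GL2AdelicWeightVectors
import Literature.NumberTheory.GaloisRepresentations.ArtinCharacterReciprocityProofs
import Literature.NumberTheory.GaloisRepresentations.HeckeCharacterWeakApproximation
import Literature.NumberTheory.GaloisRepresentations.IntegralGaloisActionProofs
import Literature.NumberTheory.GaloisRepresentations.ModNCyclotomicCharacter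
import Literature.NumberTheory.GaloisRepresentations.ArtinRepFrobeniusProofs
import Literature.NumberTheory.GaloisRepresentations.AbsGaloisGroup
import HarnessLib

/-!
# The central character of `π = π(σ)` is the reciprocity character of `det σ`; for `GL₂/ℚ` the
# archimedean parameter `{s₁, s₂}` of `π(σ)` has `s₁ + s₂ = 0`
(Gelbart 1997, Thm. 2.1 ("central character `= det σ`") and the proof of Prop. 4.2, first half)

Topic `NumberTheory/Automorphic`; proofs only (no definition, no named fact).  In the tree,
"`π = π(σ)`" for an Artin representation `σ : Γ_F → GL_n(ℂ)` and an automorphic representation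
`π = W / W'` of `GL_n(𝔸_F)` (Borel–Jacquet datum) is the almost-everywhere statement
`IsPiOfArtinRep σ π` of `StrongArtinGL2` (Tunnell 1981: `t_{π_v} ∼ σ(Fr_v)` for almost all `v`); it
carries no clause at the centre or at infinity.  Two of the three consequences of Gelbart's proof
of Prop. 4.2 (`π(σ)_∞ = π(1, sgn)` for odd `σ`: Harish-Chandra parameter `{0, 0}` and sign `-1`,
the hypothesis `harch` of `StrongArtinGL2WeightOneDictionary`) follow nevertheless from the
**central character**:

* `IsPiOfArtinRep.exists_centralCharacter_eq_det` — **the central character of `π(σ)` is the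
  Hecke character of `det σ`** (any `n`, any number field `F`): the centre `Z(𝔸_F)` acts on
  `W / W'` by a Hecke character `ω_π` with `ω_π(ϖ_v) = ∏ t_{π,v}` at every unramified `v`
  (`AutomorphicRepData.exists_centralCharacter`, Schur modulo `W'`), `∏ t_{π,v} = det σ(Fr_v)`
  wherever `t_{π,v} ∼ σ(Fr_v)` (the constant coefficient of the common characteristic polynomial),
  Artin reciprocity supplies a finite-order Hecke character `ω_{det σ}` with the same Frobenius
  values (`artinReciprocity_character_holds`), and two Hecke characters agreeing at almost all
  uniformizers are equal (`HeckeCharacter.ext_of_eventually_valueAtUniformizer_eq`).  So `ω_π` is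
  of finite order, and `ω_π(ϖ_v) = det σ(Φ)` for every arithmetic Frobenius at every `v` at which
  `σ` is unramified (Gelbart 1997, Thm. 2.1: "central character `= det σ`"; §7.1 (a)).
* `IsPiOfArtinRep.rightTranslation_posRealScalar_sub_mem` — hence **the split centre
  `A_G = ℝ_{>0}` acts trivially on `W / W'`** (a finite-order character is trivial on the
  divisible group `ℝ_{>0}`, `HeckeCharacter.map_posRealIdele_of_isFiniteOrder`).
* `IsPiOfArtinRep.add_eq_zero_of_hasArchParameter` — for `GL₂/ℚ`: **if `π(σ)` has archimedean
  Harish-Chandra parameter `{s₁, s₂}` then `s₁ + s₂ = 0`**: the central `1 ∈ 𝔤𝔩₂` acts by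
  `s₁ + s₂` (`AutomorphicRepData.lieDeriv_one_sub_smul_mem`), so `r(e^{t} · 1₂) = e^{(s₁+s₂)t}` on
  `W / W'` (`rightTranslation_expMem_scalar_sub_exp_smul_mem`), while it is `1`; and `e^{dt} = 1`
  for all real `t` forces `d = 0` (`√2 ∉ ℚ`).  This is the clause "`t₁ + t₂ = 0`" of
  `π_∞ = π(|·|^{t₁} sgn^{m₁}, |·|^{t₂} sgn^{m₂})` in Gelbart's proof of Prop. 4.2 ("since `σ_∞`
  must be trivial on the connected component … `tᵢ = 0`"), read through the centre.

* `IsPiOfArtinRep.rightTranslation_ofArch_neg_one_add_mem` — for `GL₂/ℚ` and `σ` **odd**: **the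
  archimedean `-1` acts by `-1` on `W / W'`** (the sign clause of `IsOfWeightOne`): `ω_π = ψ_χ` for
  a Dirichlet character `χ` (`exists_dirichletCharacter_of_isFiniteOrder_holds`), `ψ_χ((-1)_∞) = χ(-1)`
  (`HeckeCharacter.ofDirichlet_infIdele_neg_one`, through the ray class map of `HeckeCharacterProofs`),
  `det σ = χ ∘ χ_m` on `Γ_ℚ` (Deligne–Serre's Lemma 3.2, `lemma32_complex_holds`, as in their
  Rem. 4.4) and `χ_m(c) = -1`, `det σ(c) = -1` at a complex conjugation `c`;
* `IsPiOfArtinRep.isOfWeightOne_of_hasArchParameter_pair` — hence **`π(σ)` is of weight one as soon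
  as its archimedean parameter is a pair `{s, s}`**.

The remaining clause of `harch` — that the parameter is `{s, s}` and not `{s, -s}` with `s ≠ 0`
(`π_∞ ≠ π(|·|^{s}, |·|^{-s} sgn)`) — is Gelbart's Prop. 4.1 at the archimedean place (`π_v = π(σ_v)`
for **all** `v` from almost all `v`, a comparison of archimedean `L`-factors); it is not treated here.

## References

* S. Gelbart, *Three lectures on the modularity of `ρ̄_{E,3}` and the Langlands reciprocity
  conjecture* (1997), Thm. 2.1, Prop. 4.1, Prop. 4.2 (proof), §7.1 (a). [Gelbart1997]
* J. Tunnell, *Artin's conjecture for representations of octahedral type*, Bull. AMS 5 (1981),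
  p. 173. [Tunnell1981]
* A. Borel, H. Jacquet, *Automorphic forms and automorphic representations*, Proc. Sympos. Pure
  Math. 33 (1979), part 1, §4.6 and 5.7. [BorelJacquetCorvallis1979]
* J. W. S. Cassels, A. Fröhlich (eds.), *Algebraic Number Theory* (1967), Ch. VII §5 (Artin
  reciprocity for characters), §4 Prop. 4.1. [CasselsFrohlichANT1967]
-/

noncomputable section

open scoped MatrixGroups Matrix NumberField NNReal Polynomial Classical
open NumberField NumberField.mixedEmbedding IsDedekindDomain Polynomial

namespace Literature.NumberTheory.Automorphic

open Literature.NumberTheory.GaloisRepresentations (HeckeCharacter ideleGroup FramedArtinRep FramedRep)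
open GaloisRepresentations

/-! ### The central character of `π(σ)` is `det σ` -/

section Central

variable {n : ℕ} {F : Type} [Field F] [NumberField F] {hcpt : isCompact_glFiniteIntegralLevel n F}

/-- The determinant of a matrix whose characteristic polynomial is `∏_{a ∈ α} (X - a)` is `∏ α`
(Mathlib `Matrix.det_eq_sign_charpoly_coeff`; the constant coefficient of `∏ (X - a)` is
`(-1)^{|α|} ∏ a`). [folklore] -/
theorem det_eq_prod_of_charpoly_eq_satakePolynomial_of_card {m : Type*} [Fintype m] [DecidableEq m]
    {M : Matrix m m ℂ} {α : Multiset ℂ} (hcard : Multiset.card α = Fintype.card m)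
    (h : M.charpoly = satakePolynomial α) : M.det = α.prod := by
  rw [Matrix.det_eq_sign_charpoly_coeff, h, satakePolynomial, Polynomial.coeff_zero_eq_eval_zero,
    Polynomial.eval_multiset_prod, Multiset.map_map]
  have e : ((fun a : ℂ => X - C a : ℂ → ℂ[X]).comp fun a => a) = fun a : ℂ => X - C a := rfl
  have h1 : (α.map (Polynomial.eval 0 ∘ fun a : ℂ => X - C a)).prod = (α.map Neg.neg).prod := by
    congr 1
    refine Multiset.map_congr rfl fun a _ => ?_
    simp
  rw [h1, Multiset.prod_map_neg, hcard, ← mul_assoc, ← pow_add, ← two_mul, pow_mul, neg_one_sq, one_pow, one_mul]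

/-- **The central character of `π = π(σ)` is the reciprocity character of `det σ`** (Gelbart 1997,
Thm. 2.1: "with central character `= det σ`"; §7.1 (a): `ω_π(ϖ_v) = det t_{π,v}`).  For an Artin
representation `σ : Γ_F → GL_n(ℂ)` and an automorphic representation `π = W / W'` of `GL_n(𝔸_F)`
with `π = π(σ)` almost everywhere (`IsPiOfArtinRep`), there is a Hecke character `ω` of `F` **of
finite order** through which the centre acts on `W / W'` (`r(z · 1_n) φ - ω(z) φ ∈ W'`), and at every
finite place `v` at which `σ` is unramified, `ω` is unramified with `ω(ϖ_v) = det σ(Φ)` for every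
arithmetic Frobenius `Φ` above `v`.  Proof: `ω = ω_π` of `AutomorphicRepData.exists_centralCharacter`
has `ω(ϖ_v) = ∏ t_{π,v} = det σ(Fr_v)` at almost every `v` (`det_eq_prod_of_charpoly_eq_satakePolynomial_of_card`),
as does the finite-order Hecke character of the rank-one Artin representation `det σ`
(`artinReciprocity_character_holds`), and a Hecke character is determined by almost all of its
values at uniformizers (`HeckeCharacter.ext_of_eventually_valueAtUniformizer_eq`).
[cite: Gelbart1997, Thm. 2.1 and §7.1 (a)] [cite: CasselsFrohlichANT1967, Ch. VII §5 Thm. 5.1] -/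
theorem IsPiOfArtinRep.exists_centralCharacter_eq_det {σ : FramedArtinRep F n}
    {π : AutomorphicRepData (AutomorphyDatum.gl n F hcpt)} (h : IsPiOfArtinRep σ π) :
    ∃ ω : HeckeCharacter F, ω.IsFiniteOrder ∧
      (∀ (z : ideleGroup F), ∀ φ ∈ π.W, rightTranslation (AdelicGroupData.gl n F)
          (Matrix.GeneralLinearGroup.scalar (Fin n) z) φ - ((ω z : ℂˣ) : ℂ) • φ ∈ π.W') ∧
      ∀ v : HeightOneSpectrum (𝓞 F), σ.IsUnramifiedAt v →
        ω.IsUnramifiedAt v ∧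
          ∀ 𝔓 ∈ v.primesAbove, ∀ Φ : Field.absoluteGaloisGroup F, IsArithFrobAt (𝓞 F) Φ 𝔓 →
            ω.valueAtUniformizer v = ((FramedRep.det σ Φ : ℂˣ) : ℂ) := by
  obtain ⟨ω, hω, hsat⟩ := π.exists_centralCharacter
  -- the rank-one Artin representation `det σ`
  let χA : FramedArtinRep F 1 :=
    ContinuousMonoidHom.comp (FramedRep.unitsContinuousMulEquivOfUnique (Fin 1) ℂ : ℂˣ →ₜ* GL (Fin 1) ℂ)
      (FramedRep.det σ)
  have hχA : ∀ (γ : Field.absoluteGaloisGroup F) (i k : Fin 1),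
      ((χA γ : GL (Fin 1) ℂ) : Matrix (Fin 1) (Fin 1) ℂ) i k = ((FramedRep.det σ γ : ℂˣ) : ℂ) := fun _ _ _ => rfl
  have hχA1 : ∀ γ : Field.absoluteGaloisGroup F, σ γ = 1 → χA γ = 1 := fun γ hγ => by
    have hdet : FramedRep.det σ γ = 1 := by rw [FramedRep.det_apply, hγ, map_one]
    change (FramedRep.unitsContinuousMulEquivOfUnique (Fin 1) ℂ) (FramedRep.det σ γ) = 1
    rw [hdet, map_one]
  have hunr : ∀ v, σ.IsUnramifiedAt v → χA.IsUnramifiedAt v := fun v hv 𝔓 h𝔓 τ hτ =>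
    hχA1 τ (hv 𝔓 h𝔓 τ hτ)
  -- Artin reciprocity for `det σ`
  obtain ⟨ω', hfin', hω'⟩ := artinReciprocity_character_holds F χA
  -- `ω = ω'`: equal values at almost every uniformizer
  have heq : ω = ω' := by
    refine HeckeCharacter.ext_of_eventually_valueAtUniformizer_eq (h.mono fun v hv => ?_)
    obtain ⟨α, hαπ, hσv, hfrob⟩ := hv
    obtain ⟨𝔓, h𝔓⟩ := v.primesAbove_nonempty
    obtain ⟨Φ, hΦ⟩ := HeightOneSpectrum.exists_isArithFrobAt_of_mem_primesAbove_holds h𝔓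
    -- `ω(ϖ_v) = ∏ α`
    rw [(hsat hαπ).2]
    -- `ω'(ϖ_v) = det σ(Φ)`
    have h2 := (FramedGaloisRep.hasFrobCharpolyAt_iff_of_rank_one χA v _).mp (hω' v (hunr v hσv)).2 𝔓 h𝔓 Φ hΦ
    rw [hχA] at h2
    rw [← h2, FramedRep.det_apply, Matrix.GeneralLinearGroup.val_det_apply]
    -- `det σ(Φ) = ∏ α`
    exact (det_eq_prod_of_charpoly_eq_satakePolynomial_of_card (by rw [hαπ.card_eq, Fintype.card_fin]) (hfrob 𝔓 h𝔓 Φ hΦ)).symm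
  subst heq
  refine ⟨ω, hfin', hω, fun v hv => ⟨(hω' v (hunr v hv)).1, fun 𝔓 h𝔓 Φ hΦ => ?_⟩⟩
  have h2 := (FramedGaloisRep.hasFrobCharpolyAt_iff_of_rank_one χA v _).mp (hω' v (hunr v hv)).2 𝔓 h𝔓 Φ hΦ
  rw [hχA] at h2
  exact h2.symm

/-- **The split centre `A_G = ℝ_{>0}` acts trivially on `W / W'` for `π = π(σ)`**: `r(t · 1_n) φ - φ ∈ W'`
for `t > 0` (`ω_π` is of finite order, hence trivial on `ℝ_{>0}`,
`HeckeCharacter.map_posRealIdele_of_isFiniteOrder`). [cite: Gelbart1997, Thm. 2.1] -/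
theorem IsPiOfArtinRep.rightTranslation_posRealScalar_sub_mem {σ : FramedArtinRep F n}
    {π : AutomorphicRepData (AutomorphyDatum.gl n F hcpt)} (h : IsPiOfArtinRep σ π) (t : ℝ≥0ˣ)
    {φ : (AdelicGroupData.gl n F).Adelic → ℂ} (hφ : φ ∈ π.W) :
    rightTranslation (AdelicGroupData.gl n F) (show (AdelicGroupData.gl n F).Adelic from posRealScalar n F t) φ - φ ∈ π.W' := by
  obtain ⟨ω, hfin, hω, -⟩ := h.exists_centralCharacter_eq_det
  have h1 := hω (posRealIdele F t) φ hφ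
  rw [HeckeCharacter.map_posRealIdele_of_isFiniteOrder hfin t, Units.val_one, one_smul] at h1
  exact h1

end Central

/-! ### `GL₂/ℚ`: the archimedean parameter `{s₁, s₂}` of `π(σ)` has `s₁ + s₂ = 0` -/

section ArchSum

variable {hcpt : isCompact_glFiniteIntegralLevel 2 ℚ}

/-- `e^{d t} = 1` for all real `t` forces `d = 0` (`e^{d} = e^{d√2} = 1` would make `√2` rational).
[folklore] -/
theorem eq_zero_of_forall_exp_mul_eq_one {d : ℂ} (h : ∀ t : ℝ, Complex.exp (d * t) = 1) : d = 0 := by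
  obtain ⟨k, hk⟩ := Complex.exp_eq_one_iff.1 (by simpa using h 1)
  obtain ⟨m, hm⟩ := Complex.exp_eq_one_iff.1 (h (Real.sqrt 2))
  have h2πI : (2 * Real.pi * Complex.I : ℂ) ≠ 0 := by
    simp [Real.pi_ne_zero, Complex.I_ne_zero]
  by_cases hk0 : k = 0
  · rw [hk, hk0]; simp
  · exfalso
    -- `k √2 = m`
    have hkm : (k : ℂ) * (Real.sqrt 2 : ℂ) = m := by
      apply mul_right_cancel₀ h2πI
      rw [mul_assoc, mul_comm ((Real.sqrt 2 : ℝ) : ℂ), ← mul_assoc, ← hk, hm]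
    have hreal : (k : ℝ) * Real.sqrt 2 = m := by exact_mod_cast hkm
    have hk0' : (k : ℝ) ≠ 0 := by exact_mod_cast hk0
    refine irrational_sqrt_two ⟨(m : ℚ) / (k : ℚ), ?_⟩
    rw [Rat.cast_div, Rat.cast_intCast, Rat.cast_intCast, ← hreal, mul_div_cancel_left₀ _ hk0']

/-- `1 ⊗ 1` is the central `1 ∈ 𝔤𝔩₂(mixedSpace ℚ)`: the identity matrix of `𝔤𝔩₂(ℝ)` under
`X ↦ X ⊗ 1` (`Rat.lieOfReal`). [folklore] -/
theorem Rat.lieOfReal_one' : Rat.lieOfReal hcpt 1 = (⟨1, trivial⟩ : (AutomorphyDatum.gl 2 ℚ hcpt).arch.lie) :=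
  Subtype.ext (Matrix.map_one _ (map_zero _) (map_one _))

/-- **For `π = π(σ)` on `GL₂(𝔸_ℚ)` with archimedean parameter `{s₁, s₂}`, `s₁ + s₂ = 0`.**  The
central `1 ∈ 𝔤𝔩₂(ℝ)` acts on `W / W'` by `s₁ + s₂` (`AutomorphicRepData.lieDeriv_one_sub_smul_mem`),
so the positive scalar `e^{t} · 1₂ = exp(t · 1) ∈ A_G` acts by `e^{(s₁ + s₂) t}`
(`AutomorphicRepData.rightTranslation_expMem_scalar_sub_exp_smul_mem`,
`posRealScalar_eq_ofArch_expMem`); but `A_G` acts trivially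
(`IsPiOfArtinRep.rightTranslation_posRealScalar_sub_mem`), so `e^{(s₁ + s₂) t} = 1` for all `t` and
`s₁ + s₂ = 0`.  This is the clause "`t₁ + t₂ = 0`" in Gelbart's proof of Prop. 4.2 (`σ_∞` is
trivial on the connected component `ℂˣ`, so the parameters `tᵢ` of `π_∞(σ_∞)` vanish), obtained
here through the centre from the almost-everywhere hypothesis alone. [cite: Gelbart1997, Prop. 4.2 (proof)] -/
theorem IsPiOfArtinRep.add_eq_zero_of_hasArchParameter {σ : FramedArtinRep ℚ 2}
    {π : AutomorphicRepData (AutomorphyDatum.gl 2 ℚ hcpt)} (h : IsPiOfArtinRep σ π) {s₁ s₂ : ℂ}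
    (hπ : π.HasArchParameter fun _ => ({s₁, s₂} : Multiset ℂ)) : s₁ + s₂ = 0 := by
  set d : ℂ := s₁ + s₂ with hd_def
  -- the central `1 ∈ 𝔤` acts by `d` on `W / W'`
  have hd : ∀ φ ∈ π.W, lieDeriv (AutomorphyDatum.gl 2 ℚ hcpt).ofArch
      (⟨Matrix.scalar (Fin 2) (1 : mixedSpace ℚ), trivial⟩ : (AutomorphyDatum.gl 2 ℚ hcpt).arch.lie) φ - d • φ ∈ π.W' := by
    intro φ hφ
    have h1 := π.lieDeriv_one_sub_smul_mem hπ hφ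
    rw [← Rat.lieDeriv_ofArch_lieOfReal_eq (hcpt := hcpt), Rat.lieOfReal_one'] at h1
    have e : (⟨Matrix.scalar (Fin 2) (1 : mixedSpace ℚ), trivial⟩ : (AutomorphyDatum.gl 2 ℚ hcpt).arch.lie) = ⟨1, trivial⟩ :=
      Subtype.ext (by change Matrix.scalar (Fin 2) (1 : mixedSpace ℚ) = 1; simp)
    rw [e]
    exact h1
  -- a form outside `W'`
  obtain ⟨φ, hφW, hφW'⟩ := SetLike.exists_of_lt π.lt
  refine eq_zero_of_forall_exp_mul_eq_one fun t => ?_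
  -- `r(e^t · 1₂) φ - e^{dt} φ ∈ W'` and `r(e^t · 1₂) φ - φ ∈ W'`
  have hexp := π.rightTranslation_expMem_scalar_sub_exp_smul_mem (1 : mixedSpace ℚ) hd t hφW
  set u : ℝ≥0ˣ := Units.mk0 ⟨Real.exp t, (Real.exp_pos t).le⟩ (by
    rw [Ne, ← NNReal.coe_eq_zero]; exact (Real.exp_pos t).ne') with hu
  have hlog : Real.log ((u : ℝ≥0) : ℝ) = t := by
    change Real.log (Real.exp t) = t
    exact Real.log_exp t
  have htriv := h.rightTranslation_posRealScalar_sub_mem u hφW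
  have e : (⟨Matrix.scalar (Fin 2) (1 : mixedSpace ℚ), trivial⟩ : (AutomorphyDatum.gl 2 ℚ hcpt).arch.lie) = ⟨1, trivial⟩ :=
    Subtype.ext (by change Matrix.scalar (Fin 2) (1 : mixedSpace ℚ) = 1; simp)
  rw [e, ← hlog, ← posRealScalar_eq_ofArch_expMem (hcpt := hcpt) u, hlog] at hexp
  -- subtract: `(e^{dt} - 1) φ ∈ W'`
  have hsub : (Complex.exp (d * t) - 1) • φ ∈ π.W' := by
    have := π.W'.sub_mem htriv hexp
    rw [sub_sub_sub_cancel_left] at this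
    rwa [sub_smul, one_smul]
  by_contra hne
  apply hφW'
  have hc : Complex.exp (d * t) - 1 ≠ 0 := sub_ne_zero.2 hne
  have := π.W'.smul_mem (Complex.exp (d * t) - 1)⁻¹ hsub
  rwa [inv_smul_smul₀ hc] at this

end ArchSum

/-! ### `GL₂/ℚ`, `σ` odd: the archimedean `-1` acts by `-1` on `W / W'` -/

section Sign

open Rat.HeightOneSpectrum IsDedekindDomain.HeightOneSpectrum

variable {hcpt : isCompact_glFiniteIntegralLevel 2 ℚ}

attribute [local instance] Rat.fact_prime_natGenerator

/-- The local reduction of the principal idele `(-1)` is `-1`. [folklore] -/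
theorem Rat.localRed_principalIdele_neg_one (v : HeightOneSpectrum (𝓞 ℚ)) (k : ℕ) :
    Rat.localRed v k (GaloisRepresentations.principalIdele ℚ (-1)) = -1 := by
  refine Units.ext ?_
  rw [Rat.val_localRed, Units.val_neg, Units.val_one]
  have hval : Valued.v ((GaloisRepresentations.principalIdele ℚ (-1 : ℚˣ) : AdeleRing (𝓞 ℚ) ℚ).2 v) = 1 := by
    rw [principalIdele_snd, Units.val_neg, Units.val_one, map_neg, map_one, Valuation.map_neg, Valuation.map_one]
  have : (Rat.padicUnitPart v (GaloisRepresentations.principalIdele ℚ (-1 : ℚˣ)) : ℤ_[natGenerator v]) = -1 := by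
    refine PadicInt.ext ?_
    rw [Rat.coe_padicUnitPart_of_valued_eq_one v _ hval, Rat.padicComp_apply, principalIdele_snd,
      Rat.toPadic_algebraMap, Units.val_neg, Units.val_one, Rat.cast_neg, Rat.cast_one, PadicInt.coe_neg,
      PadicInt.coe_one]
  rw [this, map_neg, map_one]

/-- The reduction mod `m` of the principal idele `(-1)` is `-1`. [folklore] -/
theorem Rat.redMod_principalIdele_neg_one (m : ℕ) [NeZero m] : Rat.redMod m (GaloisRepresentations.principalIdele ℚ (-1)) = -1 := by
  refine Units.ext ((ZMod.equivPi (n := m) (NeZero.ne m)).injective (funext fun q => ?_))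
  rw [Rat.equivPi_redMod, Rat.val_localRedFactor, Rat.localRed_principalIdele_neg_one, Units.val_neg, Units.val_one,
    Units.val_neg, Units.val_one, map_neg, map_one, map_neg, map_one, Pi.neg_apply, Pi.one_apply]

/-- **The ray class of the archimedean idele `-1` is `-1 mod m`**: `(-1)_∞ = (-1)_ℚ · w` with
`w = (1_∞; -1, -1, …)` of positive real part and unit finite parts, so its ray class is the
reduction of `w`, which agrees with that of `(-1)_ℚ` at the finite places. [folklore] -/
theorem Rat.rayClassHom_infIdele_neg_one (m : ℕ) [NeZero m] :
    Rat.rayClassHom m (Rat.infIdele (-1)) = -1 := by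
  set p : ideleGroup ℚ := GaloisRepresentations.principalIdele ℚ (-1) with hp
  set x : ideleGroup ℚ := Rat.infIdele (-1) with hx
  have hpp : p * p = 1 := by rw [hp, ← map_mul, neg_mul_neg, one_mul, map_one]
  have hxw : x = p * (p * x) := by rw [← mul_assoc, hpp, one_mul]
  -- the idele `w = (-1)_ℚ (-1)_∞`
  have h1 : Rat.infReal p = -1 := by
    rw [hp, Rat.infReal_principalIdele, Units.val_neg, Units.val_one, Rat.cast_neg, Rat.cast_one]
  have h2 : Rat.infReal x = -1 := by
    rw [hx, Rat.infReal_infIdele, Units.val_neg, Units.val_one]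
  have hinf : 0 < Rat.infReal (p * x) := by
    rw [map_mul, h1, h2]
    norm_num
  have hval : ∀ v, Valued.v (((p * x : ideleGroup ℚ) : AdeleRing (𝓞 ℚ) ℚ).2 v) = 1 := fun v => by
    rw [ideleGroup_val_snd_mul, hp, hx, Rat.infIdele_snd, mul_one, principalIdele_snd, Units.val_neg, Units.val_one,
      map_neg, map_one, Valuation.map_neg, Valuation.map_one]
  rw [hxw, map_mul, Rat.rayClassHom_principalIdele, one_mul, Rat.rayClassHom_eq_redMod m _ hinf hval, map_mul,
    Rat.redMod_eq_one_of_snd_eq_one m (x := x) (fun q => Rat.infIdele_snd _ _), mul_one, hp,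
    Rat.redMod_principalIdele_neg_one]

/-- **A finite-order Hecke character of `ℚ` at the archimedean idele `-1` is its Dirichlet value at
`-1`**: `ψ_χ((-1)_∞) = χ(-1)` for `ψ_χ = HeckeCharacter.ofDirichlet χ` (`ψ_χ(x) = χ(u(x) mod m)⁻¹`,
the ray class of `(-1)_∞` is `-1`, and `χ(-1) = ±1`). Neukirch, *Algebraic Number Theory*, VII (6.9)
(the infinity type of a Dirichlet character). [cite: NeukirchANT1999, Ch. VII Prop. (6.9)] -/
theorem HeckeCharacter.ofDirichlet_infIdele_neg_one {m : ℕ} [NeZero m] (χ : DirichletCharacter ℂ m) :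
    ((HeckeCharacter.ofDirichlet χ (Rat.infIdele (-1)) : ℂˣ) : ℂ) = χ (-1) := by
  rw [HeckeCharacter.ofDirichlet_apply, Rat.rayClassHom_infIdele_neg_one, Units.val_inv_eq_inv_val,
    MulChar.coe_toUnitHom, Units.val_neg, Units.val_one]
  rcases χ.even_or_odd with h | h
  · rw [h, inv_one]
  · rw [h, inv_neg, inv_one]

/-- **The archimedean `-1` of the `GL₂/ℚ` datum is the scalar matrix of the archimedean idele
`-1`**: `ofArch (-1) = (-1)_∞ · 1₂` in `GL₂(𝔸_ℚ)`. [folklore] -/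
theorem ofArch_neg_one_eq_scalar_infIdele :
    (AutomorphyDatum.gl 2 ℚ hcpt).ofArch ⟨-1, trivial⟩ =
      (show (AdelicGroupData.gl 2 ℚ).Adelic from
        Matrix.GeneralLinearGroup.scalar (Fin 2) (Rat.infIdele (-1) : ideleGroup ℚ)) := by
  refine Matrix.GeneralLinearGroup.ext fun i j => ?_
  rw [AutomorphyDatum.gl_ofArch_apply, GLn.coe_ofInfinite_apply]
  change ((InfiniteAdeleRing.ringEquiv_mixedSpace ℚ).symm (((-1 : GL (Fin 2) (mixedSpace ℚ)) :
      Matrix (Fin 2) (Fin 2) (mixedSpace ℚ)) i j), (1 : Matrix (Fin 2) (Fin 2) (FiniteAdeleRing (𝓞 ℚ) ℚ)) i j) =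
    ((Matrix.GeneralLinearGroup.scalar (Fin 2) (Rat.infIdele (-1) : ideleGroup ℚ) :
      GL (Fin 2) (AdeleRing (𝓞 ℚ) ℚ)) : Matrix (Fin 2) (Fin 2) (AdeleRing (𝓞 ℚ) ℚ)) i j
  rw [Matrix.GeneralLinearGroup.coe_scalar, Matrix.scalar_apply, Matrix.diagonal_apply, Units.val_neg, Units.val_one,
    Matrix.neg_apply, Matrix.one_apply, Matrix.one_apply]
  by_cases hij : i = j
  · rw [if_pos hij, if_pos hij, if_pos hij, map_neg, map_one]
    refine Prod.ext ?_ ?_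
    · change (-1 : InfiniteAdeleRing ℚ) = ((Rat.infIdele (-1) : ideleGroup ℚ) : AdeleRing (𝓞 ℚ) ℚ).1
      funext w
      rw [Rat.infIdele_fst_apply, Units.val_neg, Units.val_one, map_neg, map_one]
      rfl
    · rfl
  · rw [if_neg hij, if_neg hij, if_neg hij, neg_zero, map_zero]
    rfl

/-- **`det σ` is the Galois character of the Dirichlet character of `ω_π`** (Deligne–Serre 1974,
Rem. 4.4, "`det(ρ) = ε`", for `π(σ)`): if the finite-order Hecke character `ψ_χ` of a Dirichlet
character `χ` mod `m` has `ψ_χ(ϖ_v) = det σ(Φ)` at every `v` at which `σ` is unramified, then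
`det σ = χ ∘ χ_m` as characters of `Γ_ℚ` (both rank-one representations have finite image, are
unramified away from `m` and the ramification of `σ`, with the common Frobenius polynomial
`X - χ(p)`; Lemma 3.2 of Deligne–Serre, `lemma32_complex_holds`). [cite: DeligneSerreASENS1974, Rem. 4.4 and Lemme 3.2] -/
theorem FramedArtinRep.det_eq_dirichletGaloisCharacter_of_valueAtUniformizer (σ : FramedArtinRep ℚ 2)
    {m : ℕ} [NeZero m] (χ : DirichletCharacter ℂ m)
    (hω : ∀ v : HeightOneSpectrum (𝓞 ℚ), σ.IsUnramifiedAt v →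
      ∀ 𝔓 ∈ v.primesAbove, ∀ Φ : Field.absoluteGaloisGroup ℚ, IsArithFrobAt (𝓞 ℚ) Φ 𝔓 →
        (HeckeCharacter.ofDirichlet χ).valueAtUniformizer v = ((FramedRep.det σ Φ : ℂˣ) : ℂ)) :
    FramedRep.det σ = dirichletGaloisCharacter ℚ χ := by
  classical
  haveI : NeZero (m : ℚ) := NeZero.charZero
  set χ₁ : GaloisRepresentations.FramedGaloisRep ℚ ℂ 1 := FramedRep.ofCharacter (FramedRep.det σ) with hχ₁
  set χ₂ : GaloisRepresentations.FramedGaloisRep ℚ ℂ 1 := FramedRep.ofCharacter (dirichletGaloisCharacter ℚ χ) with hχ₂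
  -- finite images
  have hσfin : (Set.range σ).Finite := by
    have h := finite_range_toMonoidHom σ
    have h4 : (σ.toMonoidHom.range : Set (GL (Fin 2) ℂ)) = Set.range σ := by rw [MonoidHom.coe_range]; rfl
    exact Set.finite_coe_iff.mp (h4 ▸ h)
  have hfin₁ : (Set.range χ₁).Finite := by
    refine FramedRep.finite_range_ofCharacter ?_
    have : Set.range (FramedRep.det σ) = (Matrix.GeneralLinearGroup.det : GL (Fin 2) ℂ →* ℂˣ) '' Set.range σ := by
      rw [← Set.range_comp]; rfl
    rw [this]
    exact hσfin.image _
  have hfin₂ : (Set.range χ₂).Finite :=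
    FramedRep.finite_range_ofCharacter (finite_range_dirichletGaloisCharacter ℚ χ)
  -- the exceptional primes: `m` and the ramification of `σ`
  have hram : {v : HeightOneSpectrum (𝓞 ℚ) | ¬ σ.IsUnramifiedAt v}.Finite :=
    GaloisRepresentations.FramedArtinRep.eventually_isUnramifiedAt σ
  set S : Finset ℕ := m.primeFactors ∪ (hram.image fun v => ((primesEquiv v : Nat.Primes) : ℕ)).toFinset with hS
  have hSσ : ∀ v : HeightOneSpectrum (𝓞 ℚ), ((primesEquiv v : Nat.Primes) : ℕ) ∉ S → σ.IsUnramifiedAt v := by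
    intro v hv
    by_contra hnot
    exact hv (Finset.mem_union_right _ ((Set.Finite.mem_toFinset _).2 ⟨v, hnot, rfl⟩))
  have hSm : ∀ v : HeightOneSpectrum (𝓞 ℚ), ((primesEquiv v : Nat.Primes) : ℕ) ∉ S →
      ¬ ((primesEquiv v : Nat.Primes) : ℕ) ∣ m := fun v hv hdvd =>
    hv (Finset.mem_union_left _ (Nat.mem_primeFactors.mpr ⟨(primesEquiv v).2, hdvd, NeZero.ne m⟩))
  have hequiv := GaloisRepresentations.DeligneSerre1974.lemma32_complex_holds S χ₁ χ₂ hfin₁ hfin₂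
    (FramedRep.isSemisimple_of_rank_one χ₁) (FramedRep.isSemisimple_of_rank_one χ₂) (fun v hv => ?_)
  · obtain ⟨e⟩ := hequiv
    exact FramedRep.ofCharacter_injective (FramedRep.eq_of_equiv_of_rank_one χ₁ χ₂ e)
  · have hσv := hSσ v hv
    have hpm := hSm v hv
    have hpm' : ¬ natGenerator v ∣ m := hpm
    refine ⟨?_, ?_, X - C (χ ((v.residueCard : ℕ) : ZMod m)), ?_, ?_⟩
    · intro 𝔓 h𝔓 τ hτ
      have h1 : σ τ = 1 := hσv 𝔓 h𝔓 τ hτ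
      apply Units.ext
      ext i j
      rw [Subsingleton.elim i j, hχ₁, FramedRep.ofCharacter_apply_coe, FramedRep.det_apply, h1, map_one, Units.val_one,
        Units.val_one, Matrix.one_apply_eq]
    · intro 𝔓 h𝔓 τ hτ
      haveI : 𝔓.IsPrime := h𝔓.1
      have h1 := modNCyclotomicCharacter_eq_one_of_mem_inertia (K := ℚ) (N := m)
        (Rat.natCast_not_mem_of_mem_primesAbove_of_not_dvd h𝔓 hpm) hτ
      apply Units.ext
      ext i j
      rw [Subsingleton.elim i j, hχ₂, FramedRep.ofCharacter_apply_coe, coe_dirichletGaloisCharacter_apply, h1, Units.val_one,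
        map_one, Units.val_one, Matrix.one_apply_eq]
    · intro 𝔓 h𝔓 Φ hΦ
      rw [hχ₁, FramedRep.charpoly_ofCharacter, ← hω v hσv 𝔓 h𝔓 Φ hΦ, HeckeCharacter.valueAtUniformizer_ofDirichlet χ hpm']
    · intro 𝔓 h𝔓 Φ hΦ
      haveI : 𝔓.IsPrime := h𝔓.1
      have h1 := modNCyclotomicCharacter_eq_residueCard_of_isArithFrobAt (K := ℚ) (N := m) h𝔓
        (Rat.natCast_not_mem_of_mem_primesAbove_of_not_dvd h𝔓 hpm) hΦ
      rw [hχ₂, FramedRep.charpoly_ofCharacter, coe_dirichletGaloisCharacter_apply, h1]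

/-- **For `π = π(σ)` on `GL₂(𝔸_ℚ)` with `σ` odd, the archimedean `-1` acts by `-1` on `W / W'`**:
`r((-1)_∞) φ + φ ∈ W'` for every `φ ∈ W` — the sign clause of `IsOfWeightOne`
(`StrongArtinGL2WeightOneDictionary`), i.e. `π_∞(-1) = -1`.  Proof: `(-1)_∞ · 1₂` is central, so it
acts by `ω_π((-1)_∞)` (`IsPiOfArtinRep.exists_centralCharacter_eq_det`); `ω_π = ψ_χ` for a Dirichlet
character `χ` (finite order; `exists_dirichletCharacter_of_isFiniteOrder_holds`,
`HeckeCharacter.exists_of_dirichletCharacter_holds`), `ψ_χ((-1)_∞) = χ(-1)`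
(`HeckeCharacter.ofDirichlet_infIdele_neg_one`), `det σ = χ ∘ χ_m`
(`FramedArtinRep.det_eq_dirichletGaloisCharacter_of_valueAtUniformizer`), and at a complex conjugation
`c`, `χ_m(c) = -1` and `det σ(c) = -1` (`σ` odd), whence `χ(-1) = -1`.  Gelbart 1997, proof of
Prop. 4.2: "because `det σ(τ) = -1` … `π_∞ = π(1, sgn)`", here the part visible on the centre.
[cite: Gelbart1997, Prop. 4.2 (proof)] [cite: DeligneSerreASENS1974, Rem. 4.4–4.5] -/
theorem IsPiOfArtinRep.rightTranslation_ofArch_neg_one_add_mem {σ : FramedArtinRep ℚ 2}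
    {π : AutomorphicRepData (AutomorphyDatum.gl 2 ℚ hcpt)} (h : IsPiOfArtinRep σ π)
    (hodd : GaloisRepresentations.FramedGaloisRep.IsOdd σ) {φ : (AdelicGroupData.gl 2 ℚ).Adelic → ℂ} (hφ : φ ∈ π.W) :
    rightTranslation (AdelicGroupData.gl 2 ℚ) ((AutomorphyDatum.gl 2 ℚ hcpt).ofArch ⟨-1, trivial⟩) φ + φ ∈ π.W' := by
  obtain ⟨ω, hfin, hω, hωfrob⟩ := h.exists_centralCharacter_eq_det
  -- `ω = ψ_χ` for a Dirichlet character `χ`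
  obtain ⟨m, hm, χ, hχ⟩ := HeckeCharacter.exists_dirichletCharacter_of_isFiniteOrder_holds ω hfin
  obtain ⟨ψ₁, -, huniq⟩ := HeckeCharacter.exists_of_dirichletCharacter_holds χ
  have hωψ : ω = HeckeCharacter.ofDirichlet χ := by
    rw [huniq ω ⟨hfin, hχ⟩]
    refine (huniq _ ⟨HeckeCharacter.isFiniteOrder_ofDirichlet χ, fun v hv => ?_⟩).symm
    rw [Rat.natCast_mem_asIdeal_iff] at hv
    exact ⟨HeckeCharacter.isUnramifiedAt_ofDirichlet χ hv, HeckeCharacter.valueAtUniformizer_ofDirichlet χ hv⟩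
  subst hωψ
  -- `det σ = χ ∘ χ_m`, so `χ(-1) = det σ(c) = -1`
  have hdet := FramedArtinRep.det_eq_dirichletGaloisCharacter_of_valueAtUniformizer σ χ fun v hv => (hωfrob v hv).2
  obtain ⟨c, hc⟩ := exists_isComplexConjugation (Rat.castHom ℝ)
  have hχneg : χ (-1) = -1 := by
    have h1 : FramedRep.det σ c = -1 := (GaloisRepresentations.FramedGaloisRep.isOdd_iff σ).1 hodd _ c hc
    rw [hdet] at h1
    have h2 := congrArg (fun u : ℂˣ => (u : ℂ)) h1
    simp only [coe_dirichletGaloisCharacter_apply, modNCyclotomicCharacter_of_isComplexConjugation hc, Units.val_neg,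
      Units.val_one] at h2
    exact h2
  -- the central element `(-1)_∞ · 1₂` acts by `ψ_χ((-1)_∞) = χ(-1) = -1`
  have key := hω (Rat.infIdele (-1)) φ hφ
  rw [HeckeCharacter.ofDirichlet_infIdele_neg_one, hχneg, neg_one_smul, sub_neg_eq_add] at key
  rw [ofArch_neg_one_eq_scalar_infIdele]
  exact key

/-- **`π(σ)` is of weight one as soon as its archimedean parameter is `{s, s'}` with `s = s'`**
(hence `= {0, 0}`): the two clauses of `AutomorphicRepData.IsOfWeightOne` that the centre sees.
For an odd `σ : Γ_ℚ → GL₂(ℂ)` and `π = π(σ)` almost everywhere with archimedean Harish-Chandra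
parameter `{s, s}`, `s + s = 0` (`add_eq_zero_of_hasArchParameter`) forces `s = 0`, and `-1_∞` acts
by `-1` (`rightTranslation_ofArch_neg_one_add_mem`), so `π` is of weight one.  (What the centre does
not see — that the parameter is of the form `{s, s}` rather than `{s, -s}`, `s ≠ 0`, i.e. that
`π_∞` is not `π(|·|^{s}, |·|^{-s} sgn)` — is Gelbart's Prop. 4.1 at the archimedean place.)
[cite: Gelbart1997, Prop. 4.2 (proof) and Prop. 4.1] -/
theorem IsPiOfArtinRep.isOfWeightOne_of_hasArchParameter_pair {σ : FramedArtinRep ℚ 2}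
    {π : AutomorphicRepData (AutomorphyDatum.gl 2 ℚ hcpt)} (h : IsPiOfArtinRep σ π)
    (hodd : GaloisRepresentations.FramedGaloisRep.IsOdd σ) {s : ℂ}
    (hπ : π.HasArchParameter fun _ => ({s, s} : Multiset ℂ)) : π.IsOfWeightOne := by
  have hs : s = 0 := by
    have h2 := h.add_eq_zero_of_hasArchParameter hπ
    rw [← two_mul, mul_eq_zero] at h2
    exact h2.resolve_left two_ne_zero
  subst hs
  exact ⟨hπ, fun φ hφ => h.rightTranslation_ofArch_neg_one_add_mem hodd hφ⟩

end Sign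

end Literature.NumberTheory.Automorphic

end
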